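import Summits.QuantumFields.YangMills.Theorems.BalabanUVNodesN15KingModelHeatKernelInverseSquarePackage
import Literature.MathematicalPhysics.QuantumFieldTheory.King1986.CovarianceSplitting
import HarnessLib

/-!
# BalabanUVNodes ∕ N15 — THE KING-MODEL RUNG (PART Ϻ-i): ★★★★ THE η-UNIFORM INVERSE-SQUARE LAW FOR KING's MINIMISER `ℋ = a·A₀⁻¹Q^*` (NE2's SITE layer: the background field at a fine point produced by a unit
# block spin) — `|ℋ(u,b)| ≤ a(8C_full + 5R)∕(1 + dist_M(β_u,b)²)` on `(ℤ∕LM₀)⁴ → (ℤ∕M₀)⁴` for EVERY `L ≥ 1`, EVERY `M₀ ≥ 1`, AMPLITUDE `O(1)` (the tree's Combes–Thomas bound for the minimiser has amplitude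
# `(2∕κ)L^{(d+1)∕2}e²`); the η-uniform ROW SUMS `Σ_x|A₀⁻¹(u,x)| ≤ R = 1∕m² + C_ΔS_κ∕m⁴`; both at every unitary link field as well
# (Track A, DAG node N15 = NE2; FAN-OUT v1.1 §N15 s3 «KING-MODEL RUNG … + what the curved case adds»; count-neutral)

HONEST FRAMING.  Count-neutral (cell `pub-ymgap`, seat `pub-ymgap-dag-n15-e` g56; `--supports stmt-QuantumFields-27247 --as helper` = K3ᴬ, KEY MAP v3).  King's MINIMISER ([King1986] (2.15) p.653, (2.18) p.654:
`ℋ_k = a_kG_kQ_k^*`; the tree's `King1986.Torus.minimiserMat N M a c m² = (aN^{d})·A₀⁻¹Qᵀ`, g2's NE2 SITE layer `…KingModelMinimizer`) in the one-level model at King's scaling `c = L²`: `ℋ(u,b) = a·Σ_{x∈B(b)}A₀⁻¹(u,x)`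
— the fine-lattice background field at `u` produced by the unit block spin at `b`.  What the tree held: PART Ϧ `norm_blk_minimiser_le` — `‖(G(U)Q(U)^*)_{u,b}‖ ≤ (2∕κ)L^{(d+1)∕2}e²·e^{−ctRate·d_M}` (amplitude
`L²` in `d+1 = 4`, fine `ℓ²` currency) and King's (3.71)-type two-spacing rates (g2∕g3).  THIS FILE: the amplitude is `O(1)` and the profile is inverse-square, uniformly in `η`:
* §1 (every dimension, `U ≡ 1`) ★ `sum_blockSum_lapF_inv_col_total` (`Σ_xS^x(b′) = L^{d+1}∕m²`), ★★ **`sum_abs_fineOp_inv_sub_lapF_inv_le`** (`Σ_x|A₀⁻¹(u,x) − G(u,x)| ≤ C_ΔS_κ∕m⁴` at `c = N²`), ★★★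
  **`sum_abs_fineOp_inv_le`** (THE η-UNIFORM ROW SUM `Σ_x|A₀⁻¹(u,x)| ≤ R(a,m²) = 1∕m² + C_Δ(a,d+1)S_κ∕m⁴` — the `ℓ^∞ → ℓ^∞` norm of the full propagator, every `N`, every torus);
* §2 (`d+1 = 4`) ★ `minimiserMat_eq_mul_blockSum` (`ℋ(u,b) = a·Σ_{x∈B(b)}A₀⁻¹(u,x)`), ★★ `abs_blockSum_fineOp_inv_le_rowSum` (near: `≤ R`), ★★ `abs_blockSum_fineOp_inv_le_far` (`dist_M(β_u,b) ≥ 2` ⟹ `≤ 8C_full∕(1+dist_M²)`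
  — Ϻ-d on the `L⁴` sites of `B(b)`), ★★★★ **`king_minimiser_powerLaw_eta_uniform`** (ALL `u, b`, EVERY `L`, EVERY `M₀`: `|ℋ(u,b)| ≤ a(8C_full + 5R)∕(1 + dist_M(β_u,b)²)`);
* §3 (every unitary `U`) ★ `fullOpU_inv_mul_kingQadjU_apply` (`(A₀(U)⁻¹Q(U)^*)_{(u,i),(b,k)} = Σ_j((A₀(U)⁻¹)_{u,x_j}U(Γ_{b,x_j})ᴴ)_{ik}`), ★★ `norm_fullOpU_inv_mul_kingQadjU_apply_le` (`≤ Σ_j‖(A₀(U)⁻¹)_{u,x_j}‖`), ★★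
  `sum_norm_blk_fullOpU_inv_le` (the curved row sum `Σ_x‖(A₀(U)⁻¹)_{ux}‖ ≤ R^U = 1∕m² + C′S′∕m⁴`), ★★★★ **`king_minimiserU_powerLaw_eta_uniform`** (EVERY tree contour system, EVERY unitary `U`, any fibre:
  `a‖(A₀(U)⁻¹Q(U)^*)_{(u,i),(b,k)}‖ ≤ a(8C^U_full + 5R^U)∕(1 + dist_M(β_u,b)²)` — King's covariant minimiser, amplitude `O(1)`, uniformly in `η`).
HONEST SCOPE: King's one-level comparison model; `c = L²`; `d+1 = 4` for the power laws (§1 every dimension); massive, `a > 0`; crude absolute constants; power law only (the exponential localisation on the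
block scale is the tree's Ϧ bound, with its `L^{(d+1)∕2}` amplitude — the two are complementary, not combined here); NOT Bałaban's multi-level minimisers ∕ [B9] (3.133); NOT a node discharge (N15 of record
untouched); nothing continuum ∕ ℝ⁴ ∕ OS ∕ mass gap ∕ Clay.
PRIOR TREE ART (by name): King1986.Torus `minimiserMat` (CovarianceSplitting), `fineOp`, `Qmat`, `blockSum`, `site`, `blockOf`, `CDelta`, `kapA`; Ϻ-a (`fineOp_inv_apply_eq`, `mul_transpose_Qmat_apply`, block sums), Ϻ-b
(`mul_tdistT_blockOf_le`, `sum_abs_effLaplacian_le'`), Ϻ-d (`king_fullProp_powerLaw_eta_uniform`), Ϻ-e (`one_div_le_blocks_far`), Ϻ-c (`card_offsets_four`), Ϻ-f (`norm_blk_fullOpU_inv_sub_le_doubleSum`,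
`norm_blk_effLapU_le_mass`, `kingQadjU_apply_site`, `sum_fine_eq_sum_blocks`), Ϻ-g (`king_fullPropU_powerLaw_eta_uniform`, `sum_le_of_exp_decay'`), Ͱ-b (`sum_l2_opNorm_blk_inv_le_inv_mass`), Ϧ
(`norm_entry_le_norm_blk`, `ctRate`), B4Sect5Proof `latticeConst(_nonneg)`.  Dedup (rg at filing): basename 0 files; needles
`sum_abs_fineOp_inv_le|king_minimiser_powerLaw_eta_uniform|king_minimiserU_powerLaw_eta_uniform|minimiserMat_eq_mul_blockSum|sum_norm_blk_fullOpU_inv_le|fullOpU_inv_mul_kingQadjU_apply` 0 tree files.  presearch: as Ϻ-d.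
Locators: [King1986] C. King, CMP 102 (1986) 649–677: (2.13)–(2.15) p.653, (2.18) p.654, Prop. 3.8 p.666, (3.71) p.666, (4.2) p.670, (4.44)–(4.45) p.675; [Balaban1985BackgroundPropagators] (3.19) p.393,
(3.133) Sect. D (shape, NOT asserted); [Dimock2013] App. D Lemma 30.  0 `sorry`, 0 `def`.
-/

noncomputable section

open scoped BigOperators ComplexConjugate ComplexOrder Matrix.Norms.L2Operator
open Finset Matrix

namespace Summit.QuantumFields.YangMills.BalabanUVNodes.N15KingModelRung.HeatKernel

open Literature.MathematicalPhysics.QuantumFieldTheory.LatticeDiamagneticInequality (blk)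
open Literature.MathematicalPhysics.QuantumFieldTheory.Balaban1983to89.B5Prop11Plancherel (Tor fine)
open Literature.MathematicalPhysics.QuantumFieldTheory.Balaban1983to89.Beta.WoodburyFibre (cM)
open Literature.MathematicalPhysics.QuantumFieldTheory.Balaban1983to89 (B4Sect5Proof.latticeConst B4Sect5Proof.latticeConst_nonneg)
open Literature.MathematicalPhysics.QuantumFieldTheory.King1986.Torus
  (lapF Qmat fineOp effLaplacian minimiserMat blockSum site blockOf blockOf_site tdistT tdistT_nonneg CDelta kapA kapA_pos CDelta_pos)
open Summit.QuantumFields.YangMills.BalabanUVNodes.N15KingModelRung.Covariant (covLapF l2_opNorm_blk_inv_le lapF_inv_entry_nonneg sum_l2_opNorm_blk_inv_le_inv_mass)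
open Summit.QuantumFields.YangMills.BalabanUVNodes.N15KingModelRung.CovariantBlock (BlockTree treeHol treeHol_mem_unitaryGroup covQ kingQadjU fullOpU effLapU)
open Summit.QuantumFields.YangMills.BalabanUVNodes.N15KingModelRung.CombesThomas (ctRate ctRate_pos norm_entry_le_norm_blk)
open Summit.QuantumFields.YangMills.BalabanUVNodes.N15KingModelRung.Covariant (l2_opNorm_of_mem_unitaryGroup_le)

/-! ## §1 Every dimension: the η-uniform row sums of the full propagator -/

section AnyDim

variable {d : ℕ} (N : ℕ) [NeZero N] (M : Fin (d + 1) → ℕ) [hM : ∀ μ, NeZero (M μ)] {a m2 : ℝ}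

/-- ★ `Σ_x S^x(b′) = L^{d+1}∕m²` (each of the `N^{d+1}` sites of `B(b′)` carries a full row sum `1∕m²`). [cite: King1986, (4.4) p.670, (2.16) p.653] -/
theorem sum_blockSum_lapF_inv_col_total {c : ℝ} (hc : 0 ≤ c) (hm : 0 < m2) (b' : Tor M) :
    ∑ x, blockSum N M (fun x' => (lapF (fine N M) c m2)⁻¹ x' x) b' = (N : ℝ) ^ (d + 1) * m2⁻¹ := by
  calc ∑ x, blockSum N M (fun x' => (lapF (fine N M) c m2)⁻¹ x' x) b'
      = ∑ j : Fin (d + 1) → Fin N, ∑ x, (lapF (fine N M) c m2)⁻¹ (site N M b' j) x := by rw [Finset.sum_comm]; rfl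
    _ = ∑ _j : Fin (d + 1) → Fin N, m2⁻¹ := Finset.sum_congr rfl fun j _ =>
        Summit.QuantumFields.YangMills.BalabanUVNodes.N15KingModelRung.TorusSpectral.sum_lapF_inv_eq_inv_mass (fine N M) hc hm _
    _ = (N : ℝ) ^ (d + 1) * m2⁻¹ := by
        rw [Finset.sum_const, Finset.card_univ, nsmul_eq_mul, Fintype.card_fun, Fintype.card_fin, Fintype.card_fin]; push_cast; ring

/-- ★★ **THE ROW SUMS OF THE BLOCK CORRECTION** (`c = N²`): `Σ_x|A₀⁻¹(u,x) − G(u,x)| ≤ C_Δ(a,d+1)·S_κ∕m⁴`, `S_κ = latticeConst (d+1) (κ_A(a,d+1))`, every `N`, every torus.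
[cite: King1986, (4.34) p.674, (4.44)–(4.45) p.675] -/
theorem sum_abs_fineOp_inv_sub_lapF_inv_le (ha : 0 < a) (hm : 0 < m2) (u : Tor (fine N M)) :
    ∑ x, |(fineOp N M a ((N : ℝ) ^ 2) m2)⁻¹ u x - (lapF (fine N M) ((N : ℝ) ^ 2) m2)⁻¹ u x|
      ≤ CDelta a (d + 1) * B4Sect5Proof.latticeConst (d + 1) (kapA a (d + 1)) / m2 ^ 2 := by
  have hc : (0 : ℝ) ≤ (N : ℝ) ^ 2 := by positivity
  have hNd : 0 < ((N : ℝ) ^ (d + 1)) := pow_pos (by exact_mod_cast Nat.pos_of_ne_zero (NeZero.ne N)) _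
  set G := (lapF (fine N M) ((N : ℝ) ^ 2) m2)⁻¹ with hG
  set Δ := effLaplacian N M a ((N : ℝ) ^ 2) m2 with hΔ
  set CS := CDelta a (d + 1) * B4Sect5Proof.latticeConst (d + 1) (kapA a (d + 1)) with hCS
  have hS0 := blockSum_lapF_inv_nonneg N M hc hm u
  -- pointwise: `|A₀⁻¹ − G|(u,x) ≤ N^{−(d+1)}ΣΣ S_u(b)|Δ(b,b′)|S^x(b′)`
  have hpt : ∀ x, |(fineOp N M a ((N : ℝ) ^ 2) m2)⁻¹ u x - G u x|
      ≤ ((N : ℝ) ^ (d + 1))⁻¹ * ∑ b, ∑ b', blockSum N M (fun y => G u y) b * |Δ b b'| * blockSum N M (fun y => G y x) b' := by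
    intro x
    rw [fineOp_inv_apply_eq N M ha.le hc hm u x, sub_sub_cancel_left, abs_neg, abs_mul, abs_of_pos (inv_pos.mpr hNd)]
    refine mul_le_mul_of_nonneg_left ((Finset.abs_sum_le_sum_abs _ _).trans (Finset.sum_le_sum fun b _ =>
      (Finset.abs_sum_le_sum_abs _ _).trans (Finset.sum_le_sum fun b' _ => le_of_eq ?_))) (inv_pos.mpr hNd).le
    rw [abs_mul, abs_mul, abs_of_nonneg (hS0 b), abs_of_nonneg (blockSum_lapF_inv_col_nonneg N M hc hm x b')]
  refine (Finset.sum_le_sum fun x _ => hpt x).trans ?_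
  -- sum over `x`: `Σ_x S^x(b′) = N^{d+1}∕m²`
  rw [← Finset.mul_sum]
  have hswap : ∑ x, ∑ b, ∑ b', blockSum N M (fun y => G u y) b * |Δ b b'| * blockSum N M (fun y => G y x) b'
      = ∑ b, ∑ b', blockSum N M (fun y => G u y) b * |Δ b b'| * ((N : ℝ) ^ (d + 1) * m2⁻¹) := by
    rw [Finset.sum_comm]
    refine Finset.sum_congr rfl fun b _ => ?_
    rw [Finset.sum_comm]
    refine Finset.sum_congr rfl fun b' _ => ?_
    rw [← Finset.mul_sum, sum_blockSum_lapF_inv_col_total N M hc hm b']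
  rw [hswap]
  have hrow : ∀ b, ∑ b', |Δ b b'| ≤ CS := fun b => sum_abs_effLaplacian_le' N M ha hm b
  calc ((N : ℝ) ^ (d + 1))⁻¹ * ∑ b, ∑ b', blockSum N M (fun y => G u y) b * |Δ b b'| * ((N : ℝ) ^ (d + 1) * m2⁻¹)
      = m2⁻¹ * ∑ b, blockSum N M (fun y => G u y) b * ∑ b', |Δ b b'| := by
        rw [Finset.mul_sum, Finset.mul_sum]
        refine Finset.sum_congr rfl fun b _ => ?_
        rw [Finset.mul_sum, Finset.mul_sum, Finset.mul_sum]
        exact Finset.sum_congr rfl fun b' _ => by field_simp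
    _ ≤ m2⁻¹ * ∑ b, blockSum N M (fun y => G u y) b * CS :=
        mul_le_mul_of_nonneg_left (Finset.sum_le_sum fun b _ => mul_le_mul_of_nonneg_left (hrow b) (hS0 b)) (inv_pos.mpr hm).le
    _ = CS / m2 ^ 2 := by rw [← Finset.sum_mul, sum_blockSum_lapF_inv_row N M hc hm u]; field_simp

/-- ★★★ **THE η-UNIFORM ROW SUMS OF KING's FULL PROPAGATOR** (`c = N²`): `Σ_x|A₀⁻¹(u,x)| ≤ R(a,m²) = 1∕m² + C_Δ(a,d+1)S_κ∕m⁴` for every `u`, every `N ≥ 1`, every torus — the `ℓ^∞ → ℓ^∞` norm of the full one-step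
propagator is bounded uniformly in `η` (`A₀⁻¹` need not be entrywise positive, so this is not the trivial `A₀ ≥ m²` bound). [cite: King1986, (2.13) p.653, (4.34) p.674, (4.44)–(4.45) p.675] -/
theorem sum_abs_fineOp_inv_le (ha : 0 < a) (hm : 0 < m2) (u : Tor (fine N M)) :
    ∑ x, |(fineOp N M a ((N : ℝ) ^ 2) m2)⁻¹ u x| ≤ m2⁻¹ + CDelta a (d + 1) * B4Sect5Proof.latticeConst (d + 1) (kapA a (d + 1)) / m2 ^ 2 := by
  have hc : (0 : ℝ) ≤ (N : ℝ) ^ 2 := by positivity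
  have h1 := sum_abs_fineOp_inv_sub_lapF_inv_le N M ha hm u
  have h2 : ∑ x, |(lapF (fine N M) ((N : ℝ) ^ 2) m2)⁻¹ u x| = m2⁻¹ := by
    rw [← Summit.QuantumFields.YangMills.BalabanUVNodes.N15KingModelRung.TorusSpectral.sum_lapF_inv_eq_inv_mass (fine N M) hc hm u]
    exact Finset.sum_congr rfl fun x _ => abs_of_nonneg (lapF_inv_entry_nonneg (fine N M) hc hm u x)
  calc ∑ x, |(fineOp N M a ((N : ℝ) ^ 2) m2)⁻¹ u x|
      ≤ ∑ x, (|(lapF (fine N M) ((N : ℝ) ^ 2) m2)⁻¹ u x| + |(fineOp N M a ((N : ℝ) ^ 2) m2)⁻¹ u x - (lapF (fine N M) ((N : ℝ) ^ 2) m2)⁻¹ u x|) :=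
        Finset.sum_le_sum fun x _ => by
          have := abs_add_le ((lapF (fine N M) ((N : ℝ) ^ 2) m2)⁻¹ u x) ((fineOp N M a ((N : ℝ) ^ 2) m2)⁻¹ u x - (lapF (fine N M) ((N : ℝ) ^ 2) m2)⁻¹ u x)
          rwa [add_sub_cancel] at this
    _ ≤ m2⁻¹ + CDelta a (d + 1) * B4Sect5Proof.latticeConst (d + 1) (kapA a (d + 1)) / m2 ^ 2 := by rw [Finset.sum_add_distrib, h2]; exact add_le_add le_rfl h1

/-- ★ KING's MINIMISER ENTRYWISE: `ℋ(u,b) = a·Σ_{x∈B(b)}A₀⁻¹(u,x)` (the tree's `minimiserMat = (aN^{d+1})·A₀⁻¹Qᵀ`, Ϻ-a `mul_transpose_Qmat_apply`). [cite: King1986, (2.15) p.653, (2.18) p.654] -/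
theorem minimiserMat_eq_mul_blockSum (a c m2 : ℝ) (u : Tor (fine N M)) (b : Tor M) :
    minimiserMat N M a c m2 u b = a * blockSum N M (fun x => (fineOp N M a c m2)⁻¹ u x) b := by
  have hNd : ((N : ℝ) ^ (d + 1)) ≠ 0 := pow_ne_zero _ (by exact_mod_cast NeZero.ne N)
  rw [minimiserMat, Matrix.smul_apply, smul_eq_mul, mul_transpose_Qmat_apply]
  field_simp

/-- ★★ NEAR: `|Σ_{x∈B(b)}A₀⁻¹(u,x)| ≤ Σ_x|A₀⁻¹(u,x)| ≤ R(a,m²)` (`c = N²`). [cite: King1986, (2.15) p.653, (4.44) p.675] -/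
theorem abs_blockSum_fineOp_inv_le_rowSum (ha : 0 < a) (hm : 0 < m2) (u : Tor (fine N M)) (b : Tor M) :
    |blockSum N M (fun x => (fineOp N M a ((N : ℝ) ^ 2) m2)⁻¹ u x) b| ≤ m2⁻¹ + CDelta a (d + 1) * B4Sect5Proof.latticeConst (d + 1) (kapA a (d + 1)) / m2 ^ 2 := by
  refine le_trans ?_ (sum_abs_fineOp_inv_le N M ha hm u)
  calc |blockSum N M (fun x => (fineOp N M a ((N : ℝ) ^ 2) m2)⁻¹ u x) b|
      ≤ ∑ j : Fin (d + 1) → Fin N, |(fineOp N M a ((N : ℝ) ^ 2) m2)⁻¹ u (site N M b j)| := Finset.abs_sum_le_sum_abs _ _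
    _ ≤ ∑ b' : Tor M, ∑ j : Fin (d + 1) → Fin N, |(fineOp N M a ((N : ℝ) ^ 2) m2)⁻¹ u (site N M b' j)| := by
        have h := Finset.single_le_sum (s := (Finset.univ : Finset (Tor M))) (f := fun b' : Tor M => ∑ j : Fin (d + 1) → Fin N, |(fineOp N M a ((N : ℝ) ^ 2) m2)⁻¹ u (site N M b' j)|)
          (fun b' _ => Finset.sum_nonneg fun _ _ => abs_nonneg _) (Finset.mem_univ b)
        exact h
    _ = ∑ x, |(fineOp N M a ((N : ℝ) ^ 2) m2)⁻¹ u x| := (sum_fine_eq_sum_blocks M (fun x => |(fineOp N M a ((N : ℝ) ^ 2) m2)⁻¹ u x|)).symm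

end AnyDim

/-! ## §2 Four dimensions: King's minimiser obeys the inverse-square law with amplitude `O(1)` -/

section Four

variable (L M₀ : ℕ) [NeZero L] [NeZero M₀] {a m2 : ℝ}

/-- ★★ FAR: if `dist_M(β_u, b) ≥ 2` then `|Σ_{x∈B(b)}A₀⁻¹(u,x)| ≤ 8C_full(a,m²)∕(1 + dist_M(β_u,b)²)` (Ϻ-d on each of the `L⁴` sites of `B(b)`, all at fine distance `≥ L(D−1)+1` from `u`).
[cite: King1986, (2.13)–(2.15) p.653, (3.63) p.663] -/
theorem abs_blockSum_fineOp_inv_le_far (ha : 0 < a) (hm : 0 < m2) (u : Tor (fine L (cM M₀))) (b : Tor (cM M₀)) (hD : 2 ≤ tdistT (cM M₀) (blockOf L (cM M₀) u) b) :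
    |blockSum L (cM M₀) (fun x => (fineOp L (cM M₀) a ((L : ℝ) ^ 2) m2)⁻¹ u x) b|
      ≤ 8 * ((34016 + 10 / m2) * (1 + 98 * (CDelta a 4 * B4Sect5Proof.latticeConst 4 (kapA a 4)) / m2) + 50 * CDelta a 4 * (1 + (kapA a 4 ^ 2)⁻¹) / m2 ^ 2)
          / (1 + tdistT (cM M₀) (blockOf L (cM M₀) u) b ^ 2) := by
  have hL1 : (1 : ℝ) ≤ L := by exact_mod_cast Nat.one_le_iff_ne_zero.mpr (NeZero.ne L)
  have hL2 : (0 : ℝ) < (L : ℝ) ^ 2 := by positivity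
  have hL4 : (0 : ℝ) < (L : ℝ) ^ 4 := by positivity
  set CF := (34016 + 10 / m2) * (1 + 98 * (CDelta a 4 * B4Sect5Proof.latticeConst 4 (kapA a 4)) / m2) + 50 * CDelta a 4 * (1 + (kapA a 4 ^ 2)⁻¹) / m2 ^ 2 with hCF
  have hCS := CDelta_mul_latticeConst_nonneg ha
  have hCD := (CDelta_pos ha 4).le
  have hκ : 0 ≤ (kapA a 4 ^ 2)⁻¹ := inv_nonneg.mpr (pow_pos (kapA_pos ha 4) 2).le
  have hCF0 : 0 ≤ CF := by positivity
  set D := tdistT (cM M₀) (blockOf L (cM M₀) u) b with hDdef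
  have hterm : ∀ j : Fin 4 → Fin L, |(fineOp L (cM M₀) a ((L : ℝ) ^ 2) m2)⁻¹ u (site L (cM M₀) b j)| ≤ 8 * CF / ((L : ℝ) ^ 4 * (1 + D ^ 2)) := by
    intro j
    have hs := mul_tdistT_blockOf_le L (cM M₀) u b j
    have hpl := king_fullProp_powerLaw_eta_uniform L M₀ ha hm u (site L (cM M₀) b j)
    have hfar := one_div_le_blocks_far (s := tdistT (fine L (cM M₀)) u (site L (cM M₀) b j)) hL1 hD (by linarith)
    calc |(fineOp L (cM M₀) a ((L : ℝ) ^ 2) m2)⁻¹ u (site L (cM M₀) b j)|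
        ≤ (CF / (1 + tdistT (fine L (cM M₀)) u (site L (cM M₀) b j) ^ 2)) / (L : ℝ) ^ 2 := by rw [le_div_iff₀ hL2, mul_comm]; exact hpl
      _ = (CF / (L : ℝ) ^ 2) * (1 / (1 + tdistT (fine L (cM M₀)) u (site L (cM M₀) b j) ^ 2)) := by ring
      _ ≤ (CF / (L : ℝ) ^ 2) * (8 / ((L : ℝ) ^ 2 * (1 + D ^ 2))) := mul_le_mul_of_nonneg_left hfar (by positivity)
      _ = 8 * CF / ((L : ℝ) ^ 4 * (1 + D ^ 2)) := by rw [div_mul_div_comm]; ring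
  calc |blockSum L (cM M₀) (fun x => (fineOp L (cM M₀) a ((L : ℝ) ^ 2) m2)⁻¹ u x) b|
      ≤ ∑ j : Fin 4 → Fin L, |(fineOp L (cM M₀) a ((L : ℝ) ^ 2) m2)⁻¹ u (site L (cM M₀) b j)| := Finset.abs_sum_le_sum_abs _ _
    _ ≤ ∑ _j : Fin 4 → Fin L, 8 * CF / ((L : ℝ) ^ 4 * (1 + D ^ 2)) := Finset.sum_le_sum fun j _ => hterm j
    _ = 8 * CF / (1 + D ^ 2) := by rw [Finset.sum_const, Finset.card_univ, nsmul_eq_mul, card_offsets_four]; field_simp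

/-- ★★★★ **THE η-UNIFORM INVERSE-SQUARE LAW FOR KING's MINIMISER** (NE2's SITE layer): for ALL fine points `u` and blocks `b` of `(ℤ∕LM₀)⁴ → (ℤ∕M₀)⁴`, EVERY `L ≥ 1`, EVERY `M₀ ≥ 1` (`a, m² > 0`):
`|ℋ(u,b)| = a|Σ_{x∈B(b)}A₀⁻¹(u,x)| ≤ a·(8C_full + 5R)∕(1 + dist_M(β_u,b)²)`, `C_full` of Ϻ-d, `R = 1∕m² + C_ΔS_κ∕m⁴` — AMPLITUDE `O(1)`, uniformly in `η` (the block-averaged background field of a unit block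
spin is bounded and decays like the inverse square of the block distance). [cite: King1986, (2.15) p.653, (2.18) p.654, Prop. 3.8 p.666, (4.2) p.670] -/
theorem king_minimiser_powerLaw_eta_uniform (ha : 0 < a) (hm : 0 < m2) (u : Tor (fine L (cM M₀))) (b : Tor (cM M₀)) :
    |minimiserMat L (cM M₀) a ((L : ℝ) ^ 2) m2 u b|
      ≤ a * (8 * ((34016 + 10 / m2) * (1 + 98 * (CDelta a 4 * B4Sect5Proof.latticeConst 4 (kapA a 4)) / m2) + 50 * CDelta a 4 * (1 + (kapA a 4 ^ 2)⁻¹) / m2 ^ 2)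
          + 5 * (m2⁻¹ + CDelta a 4 * B4Sect5Proof.latticeConst 4 (kapA a 4) / m2 ^ 2)) / (1 + tdistT (cM M₀) (blockOf L (cM M₀) u) b ^ 2) := by
  set CF := (34016 + 10 / m2) * (1 + 98 * (CDelta a 4 * B4Sect5Proof.latticeConst 4 (kapA a 4)) / m2) + 50 * CDelta a 4 * (1 + (kapA a 4 ^ 2)⁻¹) / m2 ^ 2 with hCF
  set R := m2⁻¹ + CDelta a 4 * B4Sect5Proof.latticeConst 4 (kapA a 4) / m2 ^ 2 with hR
  set D := tdistT (cM M₀) (blockOf L (cM M₀) u) b with hDdef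
  have hCS := CDelta_mul_latticeConst_nonneg ha
  have hCD := (CDelta_pos ha 4).le
  have hκ : 0 ≤ (kapA a 4 ^ 2)⁻¹ := inv_nonneg.mpr (pow_pos (kapA_pos ha 4) 2).le
  have hCF0 : 0 ≤ CF := by positivity
  have hR0 : 0 ≤ R := by positivity
  have hD0 : 0 ≤ D := tdistT_nonneg (cM M₀) _ _
  have hDpos : 0 < 1 + D ^ 2 := by positivity
  rw [minimiserMat_eq_mul_blockSum, abs_mul, abs_of_pos ha, mul_div_assoc]
  refine mul_le_mul_of_nonneg_left ?_ ha.le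
  rcases le_or_gt 2 D with hD | hD
  · refine (abs_blockSum_fineOp_inv_le_far L M₀ ha hm u b hD).trans (div_le_div_of_nonneg_right (by nlinarith) hDpos.le)
  · have hnear := abs_blockSum_fineOp_inv_le_rowSum L (cM M₀) ha hm u b
    have h5 : 1 + D ^ 2 < 5 := by nlinarith
    rw [le_div_iff₀ hDpos]
    calc |blockSum L (cM M₀) (fun x => (fineOp L (cM M₀) a ((L : ℝ) ^ 2) m2)⁻¹ u x) b| * (1 + D ^ 2) ≤ R * 5 := by
          have : CDelta a (3 + 1) * B4Sect5Proof.latticeConst (3 + 1) (kapA a (3 + 1)) / m2 ^ 2 = CDelta a 4 * B4Sect5Proof.latticeConst 4 (kapA a 4) / m2 ^ 2 := by norm_num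
          rw [this] at hnear
          exact mul_le_mul hnear h5.le hDpos.le hR0
      _ ≤ 8 * CF + 5 * R := by nlinarith

end Four

/-! ## §3 At every unitary link field -/

section Curved

variable {L : ℕ} [NeZero L] (T : BlockTree 3 L) (M₀ : ℕ) [NeZero M₀]
variable {𝕜 : Type*} [RCLike 𝕜] {n : Type*} [Fintype n] [DecidableEq n] {a m2 : ℝ}

/-- ★ THE ENTRIES OF THE COVARIANT MINIMISER through fine blocks: `(A₀(U)⁻¹Q(U)^*)_{(u,i),(b,k)} = Σ_j ((A₀(U)⁻¹)_{u,x_j}·U(Γ_{b,x_j})ᴴ)_{ik}`, `x_j = site b j`.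
[cite: King1986, (2.15) p.653; Balaban1985BackgroundPropagators, (3.19) p.393] -/
theorem fullOpU_inv_mul_kingQadjU_apply (a c m2 : ℝ) (U : Tor (fine L (cM M₀)) × Fin 4 → Matrix n n 𝕜) (u : Tor (fine L (cM M₀))) (b : Tor (cM M₀)) (i k : n) :
    ((fullOpU T (cM M₀) a c m2 U)⁻¹ * kingQadjU T (cM M₀) U) (u, i) (b, k)
      = ∑ j : Fin 4 → Fin L, (blk ((fullOpU T (cM M₀) a c m2 U)⁻¹) u (site L (cM M₀) b j) * (treeHol (cM M₀) T U b j)ᴴ) i k := by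
  rw [Matrix.mul_apply, ← (Literature.MathematicalPhysics.QuantumFieldTheory.King1986.Torus.blockEquiv L (cM M₀)).prodCongr (Equiv.refl n) |>.sum_comp]
  rw [Fintype.sum_prod_type, Fintype.sum_prod_type, Finset.sum_eq_single b]
  · refine Finset.sum_congr rfl fun j _ => ?_
    rw [Matrix.mul_apply]
    refine Finset.sum_congr rfl fun i' _ => ?_
    simp only [Equiv.prodCongr_apply, Equiv.coe_refl, Prod.map_apply, id_eq, Literature.MathematicalPhysics.QuantumFieldTheory.King1986.Torus.blockEquiv_apply, blk, Matrix.of_apply,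
      Matrix.conjTranspose_apply, kingQadjU_apply_site, if_true]
  · intro b' _ hb'
    refine Finset.sum_eq_zero fun j _ => Finset.sum_eq_zero fun i' _ => ?_
    simp only [Equiv.prodCongr_apply, Equiv.coe_refl, Prod.map_apply, id_eq, Literature.MathematicalPhysics.QuantumFieldTheory.King1986.Torus.blockEquiv_apply, kingQadjU_apply_site,
      if_neg (Ne.symm hb'), mul_zero]
  · intro h; exact absurd (Finset.mem_univ b) h

/-- ★★ … hence `‖(A₀(U)⁻¹Q(U)^*)_{(u,i),(b,k)}‖ ≤ Σ_j‖(A₀(U)⁻¹)_{u,x_j}‖` (unitary transports, entry ≤ block norm). [cite: Balaban1985BackgroundPropagators, (3.19) p.393] -/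
theorem norm_fullOpU_inv_mul_kingQadjU_apply_le (a c m2 : ℝ) {U : Tor (fine L (cM M₀)) × Fin 4 → Matrix n n 𝕜} (hU : ∀ bd, U bd ∈ Matrix.unitaryGroup n 𝕜)
    (u : Tor (fine L (cM M₀))) (b : Tor (cM M₀)) (i k : n) :
    ‖((fullOpU T (cM M₀) a c m2 U)⁻¹ * kingQadjU T (cM M₀) U) (u, i) (b, k)‖ ≤ ∑ j : Fin 4 → Fin L, ‖blk ((fullOpU T (cM M₀) a c m2 U)⁻¹) u (site L (cM M₀) b j)‖ := by
  rw [fullOpU_inv_mul_kingQadjU_apply]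
  refine (norm_sum_le _ _).trans (Finset.sum_le_sum fun j _ => ?_)
  refine (norm_entry_le_norm_blk _ i k).trans ((norm_mul_le _ _).trans ?_)
  have h2 : ‖(treeHol (cM M₀) T U b j)ᴴ‖ ≤ 1 := by
    have : (treeHol (cM M₀) T U b j)ᴴ ∈ Matrix.unitaryGroup n 𝕜 := by
      simpa only [star_eq_conjTranspose] using Unitary.star_mem (treeHol_mem_unitaryGroup T (cM M₀) hU b j)
    exact l2_opNorm_of_mem_unitaryGroup_le this
  calc ‖blk ((fullOpU T (cM M₀) a c m2 U)⁻¹) u (site L (cM M₀) b j)‖ * ‖(treeHol (cM M₀) T U b j)ᴴ‖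
      ≤ ‖blk ((fullOpU T (cM M₀) a c m2 U)⁻¹) u (site L (cM M₀) b j)‖ * 1 := mul_le_mul_of_nonneg_left h2 (norm_nonneg _)
    _ = _ := mul_one _

/-- ★★ **THE η-UNIFORM ROW SUMS OF THE FULL BACKGROUND PROPAGATOR AT EVERY UNITARY `U`** (`c = L²`): `Σ_x‖(A₀(U)⁻¹)_{ux}‖ ≤ R^U(a,m²) = 1∕m² + (a + 2a²e²∕m²)·latticeConst 4 (ctRate(m²,a,3))∕m⁴`.
[cite: King1986, (4.34) p.674, (4.44)–(4.45) p.675; Balaban1985BackgroundPropagators, (3.23)–(3.25) p.394] -/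
theorem sum_norm_blk_fullOpU_inv_le (ha : 0 < a) (hm : 0 < m2) {U : Tor (fine L (cM M₀)) × Fin 4 → Matrix n n 𝕜} (hU : ∀ bd, U bd ∈ Matrix.unitaryGroup n 𝕜) (u : Tor (fine L (cM M₀))) :
    ∑ x, ‖blk ((fullOpU T (cM M₀) a ((L : ℝ) ^ 2) m2 U)⁻¹) u x‖ ≤ m2⁻¹ + (a + a ^ 2 * (2 / m2) * Real.exp 2) * B4Sect5Proof.latticeConst 4 (ctRate m2 a 3) / m2 ^ 2 := by
  have hc : (0 : ℝ) ≤ (L : ℝ) ^ 2 := by positivity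
  have hL4 : 0 < ((L : ℝ) ^ (3 + 1)) := pow_pos (by exact_mod_cast Nat.pos_of_ne_zero (NeZero.ne L)) _
  set A := (fullOpU T (cM M₀) a ((L : ℝ) ^ 2) m2 U)⁻¹ with hA
  set Mi := (covLapF (fine L (cM M₀)) ((L : ℝ) ^ 2) m2 U)⁻¹ with hMi
  set G := (lapF (fine L (cM M₀)) ((L : ℝ) ^ 2) m2)⁻¹ with hG
  set Δt := fun b b' => ‖blk (effLapU T (cM M₀) a ((L : ℝ) ^ 2) m2 U) b b'‖ with hΔt
  set C' := a + a ^ 2 * (2 / m2) * Real.exp 2 with hC'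
  set CS := C' * B4Sect5Proof.latticeConst 4 (ctRate m2 a 3) with hCS
  have hC'0 : 0 ≤ C' := by positivity
  have hS0 := blockSum_lapF_inv_nonneg L (cM M₀) hc hm u
  -- split `A = Mi + (A − Mi)`
  have h1 : ∑ x, ‖blk A u x‖ ≤ ∑ x, ‖blk Mi u x‖ + ∑ x, ‖blk A u x - blk Mi u x‖ := by
    rw [← Finset.sum_add_distrib]
    exact Finset.sum_le_sum fun x _ => by
      have := norm_add_le (blk Mi u x) (blk A u x - blk Mi u x); rwa [add_sub_cancel] at this
  have h2 : ∑ x, ‖blk Mi u x‖ ≤ m2⁻¹ := sum_l2_opNorm_blk_inv_le_inv_mass (fine L (cM M₀)) hc hm hU u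
  -- the correction, summed over `x`
  have hpt : ∀ x, ‖blk A u x - blk Mi u x‖ ≤ ((L : ℝ) ^ (3 + 1))⁻¹ * ∑ b, ∑ b', blockSum L (cM M₀) (fun y => G u y) b * Δt b b' * blockSum L (cM M₀) (fun y => G y x) b' :=
    fun x => norm_blk_fullOpU_inv_sub_le_doubleSum T (cM M₀) ha hc hm hU u x
  have h3 : ∑ x, ‖blk A u x - blk Mi u x‖ ≤ CS / m2 ^ 2 := by
    refine (Finset.sum_le_sum fun x _ => hpt x).trans ?_
    rw [← Finset.mul_sum]
    have hswap : ∑ x, ∑ b, ∑ b', blockSum L (cM M₀) (fun y => G u y) b * Δt b b' * blockSum L (cM M₀) (fun y => G y x) b'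
        = ∑ b, ∑ b', blockSum L (cM M₀) (fun y => G u y) b * Δt b b' * ((L : ℝ) ^ (3 + 1) * m2⁻¹) := by
      rw [Finset.sum_comm]
      refine Finset.sum_congr rfl fun b _ => ?_
      rw [Finset.sum_comm]
      refine Finset.sum_congr rfl fun b' _ => ?_
      rw [← Finset.mul_sum, sum_blockSum_lapF_inv_col_total L (cM M₀) hc hm b']
    rw [hswap]
    have hrow : ∀ b, ∑ b', Δt b b' ≤ CS := fun b =>
      sum_le_of_exp_decay' M₀ hC'0 (ctRate_pos hm ha.le 3) (fun b b' => norm_blk_effLapU_le_mass T (cM M₀) ha.le hm hU b b') b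
    calc ((L : ℝ) ^ (3 + 1))⁻¹ * ∑ b, ∑ b', blockSum L (cM M₀) (fun y => G u y) b * Δt b b' * ((L : ℝ) ^ (3 + 1) * m2⁻¹)
        = m2⁻¹ * ∑ b, blockSum L (cM M₀) (fun y => G u y) b * ∑ b', Δt b b' := by
          rw [Finset.mul_sum, Finset.mul_sum]
          refine Finset.sum_congr rfl fun b _ => ?_
          rw [Finset.mul_sum, Finset.mul_sum, Finset.mul_sum]
          exact Finset.sum_congr rfl fun b' _ => by field_simp
      _ ≤ m2⁻¹ * ∑ b, blockSum L (cM M₀) (fun y => G u y) b * CS :=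
          mul_le_mul_of_nonneg_left (Finset.sum_le_sum fun b _ => mul_le_mul_of_nonneg_left (hrow b) (hS0 b)) (inv_pos.mpr hm).le
      _ = CS / m2 ^ 2 := by rw [← Finset.sum_mul, sum_blockSum_lapF_inv_row L (cM M₀) hc hm u]; field_simp
  linarith

/-- ★★★★ **THE η-UNIFORM INVERSE-SQUARE LAW FOR THE COVARIANT MINIMISER AT EVERY UNITARY LINK FIELD**: for every tree contour system, EVERY unitary `U`, any `RCLike` fibre, all `u`, `b`, `i`, `k`,
every `L ≥ 1`, every `M₀ ≥ 1`: `a·‖(A₀(U)⁻¹Q(U)^*)_{(u,i),(b,k)}‖ ≤ a(8C^U_full + 5R^U)∕(1 + dist_M(β_u,b)²)` — King's covariant minimiser `ℋ(U) = aG(U)Q(U)^*` has amplitude `O(1)` and an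
inverse-square profile in the block distance, uniformly in `η` and in the background. [cite: King1986, (2.15) p.653, (2.18) p.654; Balaban1985BackgroundPropagators, (3.19) p.393, (3.24)–(3.26) p.394, (3.133) Sect. D (shape)] -/
theorem king_minimiserU_powerLaw_eta_uniform (ha : 0 < a) (hm : 0 < m2) {U : Tor (fine L (cM M₀)) × Fin 4 → Matrix n n 𝕜} (hU : ∀ bd, U bd ∈ Matrix.unitaryGroup n 𝕜)
    (u : Tor (fine L (cM M₀))) (b : Tor (cM M₀)) (i k : n) :
    a * ‖((fullOpU T (cM M₀) a ((L : ℝ) ^ 2) m2 U)⁻¹ * kingQadjU T (cM M₀) U) (u, i) (b, k)‖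
      ≤ a * (8 * ((34016 + 10 / m2) * (1 + 98 * ((a + a ^ 2 * (2 / m2) * Real.exp 2) * B4Sect5Proof.latticeConst 4 (ctRate m2 a 3)) / m2)
              + 50 * (a + a ^ 2 * (2 / m2) * Real.exp 2) * (1 + (ctRate m2 a 3 ^ 2)⁻¹) / m2 ^ 2)
          + 5 * (m2⁻¹ + (a + a ^ 2 * (2 / m2) * Real.exp 2) * B4Sect5Proof.latticeConst 4 (ctRate m2 a 3) / m2 ^ 2)) / (1 + tdistT (cM M₀) (blockOf L (cM M₀) u) b ^ 2) := by
  have hL1 : (1 : ℝ) ≤ L := by exact_mod_cast Nat.one_le_iff_ne_zero.mpr (NeZero.ne L)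
  have hL2 : (0 : ℝ) < (L : ℝ) ^ 2 := by positivity
  have hL4 : (0 : ℝ) < (L : ℝ) ^ 4 := by positivity
  set CF := (34016 + 10 / m2) * (1 + 98 * ((a + a ^ 2 * (2 / m2) * Real.exp 2) * B4Sect5Proof.latticeConst 4 (ctRate m2 a 3)) / m2)
      + 50 * (a + a ^ 2 * (2 / m2) * Real.exp 2) * (1 + (ctRate m2 a 3 ^ 2)⁻¹) / m2 ^ 2 with hCF
  set R := m2⁻¹ + (a + a ^ 2 * (2 / m2) * Real.exp 2) * B4Sect5Proof.latticeConst 4 (ctRate m2 a 3) / m2 ^ 2 with hR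
  set D := tdistT (cM M₀) (blockOf L (cM M₀) u) b with hDdef
  set A := (fullOpU T (cM M₀) a ((L : ℝ) ^ 2) m2 U)⁻¹ with hA
  have hCS : 0 ≤ (a + a ^ 2 * (2 / m2) * Real.exp 2) * B4Sect5Proof.latticeConst 4 (ctRate m2 a 3) :=
    mul_nonneg (by positivity) (B4Sect5Proof.latticeConst_nonneg 4 (ctRate_pos hm ha.le 3).le)
  have hκ : 0 ≤ (ctRate m2 a 3 ^ 2)⁻¹ := inv_nonneg.mpr (pow_pos (ctRate_pos hm ha.le 3) 2).le
  have hCF0 : 0 ≤ CF := by positivity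
  have hR0 : 0 ≤ R := by positivity
  have hD0 : 0 ≤ D := tdistT_nonneg (cM M₀) _ _
  have hDpos : 0 < 1 + D ^ 2 := by positivity
  rw [mul_div_assoc]
  refine mul_le_mul_of_nonneg_left ?_ ha.le
  have hsum := norm_fullOpU_inv_mul_kingQadjU_apply_le T M₀ a ((L : ℝ) ^ 2) m2 hU u b i k
  rcases le_or_gt 2 D with hD | hD
  · -- far: every block is `≤ 8CF∕(L⁴(1+D²))`
    have hterm : ∀ j : Fin 4 → Fin L, ‖blk A u (site L (cM M₀) b j)‖ ≤ 8 * CF / ((L : ℝ) ^ 4 * (1 + D ^ 2)) := by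
      intro j
      have hs := mul_tdistT_blockOf_le L (cM M₀) u b j
      have hpl := king_fullPropU_powerLaw_eta_uniform T M₀ ha hm hU u (site L (cM M₀) b j)
      have hfar := one_div_le_blocks_far (s := tdistT (fine L (cM M₀)) u (site L (cM M₀) b j)) hL1 hD (by linarith)
      calc ‖blk A u (site L (cM M₀) b j)‖
          ≤ (CF / (1 + tdistT (fine L (cM M₀)) u (site L (cM M₀) b j) ^ 2)) / (L : ℝ) ^ 2 := by rw [le_div_iff₀ hL2, mul_comm]; exact hpl
        _ = (CF / (L : ℝ) ^ 2) * (1 / (1 + tdistT (fine L (cM M₀)) u (site L (cM M₀) b j) ^ 2)) := by ring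
        _ ≤ (CF / (L : ℝ) ^ 2) * (8 / ((L : ℝ) ^ 2 * (1 + D ^ 2))) := mul_le_mul_of_nonneg_left hfar (by positivity)
        _ = 8 * CF / ((L : ℝ) ^ 4 * (1 + D ^ 2)) := by rw [div_mul_div_comm]; ring
    calc ‖(A * kingQadjU T (cM M₀) U) (u, i) (b, k)‖ ≤ ∑ j : Fin 4 → Fin L, ‖blk A u (site L (cM M₀) b j)‖ := hsum
      _ ≤ ∑ _j : Fin 4 → Fin L, 8 * CF / ((L : ℝ) ^ 4 * (1 + D ^ 2)) := Finset.sum_le_sum fun j _ => hterm j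
      _ = 8 * CF / (1 + D ^ 2) := by rw [Finset.sum_const, Finset.card_univ, nsmul_eq_mul, card_offsets_four]; field_simp
      _ ≤ (8 * CF + 5 * R) / (1 + D ^ 2) := div_le_div_of_nonneg_right (by nlinarith) hDpos.le
  · -- near: the row sum
    have hrow := sum_norm_blk_fullOpU_inv_le T M₀ ha hm hU u
    have hblocks : ∑ j : Fin 4 → Fin L, ‖blk A u (site L (cM M₀) b j)‖ ≤ ∑ x, ‖blk A u x‖ := by
      rw [sum_fine_eq_sum_blocks (cM M₀) (fun x => ‖blk A u x‖)]
      have h := Finset.single_le_sum (s := (Finset.univ : Finset (Tor (cM M₀)))) (f := fun b' : Tor (cM M₀) => ∑ j : Fin (3 + 1) → Fin L, ‖blk A u (site L (cM M₀) b' j)‖)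
        (fun b' _ => Finset.sum_nonneg fun _ _ => norm_nonneg _) (Finset.mem_univ b)
      exact h
    have h5 : 1 + D ^ 2 < 5 := by nlinarith
    rw [le_div_iff₀ hDpos]
    calc ‖(A * kingQadjU T (cM M₀) U) (u, i) (b, k)‖ * (1 + D ^ 2) ≤ R * 5 := mul_le_mul (hsum.trans (hblocks.trans hrow)) h5.le hDpos.le hR0
      _ ≤ 8 * CF + 5 * R := by nlinarith

end Curved

end Summit.QuantumFields.YangMills.BalabanUVNodes.N15KingModelRung.HeatKernel

end
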